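import Summits.KontsevichZagierPeriods.Zeta5Search.Certificates.VIMLevel2K2Nat
import Summits.KontsevichZagierPeriods.Zeta5Search.Families.CellularVIMRecurrenceLaws
import HarnessLib

/-!
# ζ(5) search — brown9 LEVEL 3 (outer sum): the 6-fold sum `A(n)` as `Σ_{k₃} (−1)^{k₃} C(n,k₃) · L(n,k₃) · R(n,k₃)` (cell `pub-zeta5`, certifier `cert-1`)

HONEST FRAMING: systematic search; no irrationality claim unless certified.

The leading coefficient `A(n) = leading (basic n) (basic n)` of fam-brown9's "vanishing in the middle" family
(`Cells/VanishingMiddleLeading.lean`, a 6-fold terminating binomial sum written with `sumUpTo`/`shiftBinom`, and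
`Families/CellularVIMRecurrenceLaws.A`) FACTORISES through the inner blocks of the ttrl2 lane's nesting
(`run/shared/lean/ttrl/zeta5-calc/brown9/VIM.md` §1 (ii), §2):
  `A(n) = Σ_{k₃ ≤ n} (−1)^{k₃} C(n,k₃) · L(n,k₃) · R(n,k₃)`,
  `R(n,k₃) = Σ_{k₅} (−1)^{k₅} C(n,k₅) C(3n−k₃−k₅,n) · T(n; 3n−k₃−k₅, 2n−k₅)` (sums over `k₅, k₆`),
  `L(n,k₃) = Σ_{k₂} (−1)^{k₂} C(n,k₂) · T(n; 3n−k₃−k₂, 3n−k₃) · T(n; 3n−k₃−k₂, 2n−k₂)` (sums over `k₂, k₄, k₁`),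
with `T(n;p,q) = Σ_k (−1)^k C(n,k) C(p−k,n) C(q−k,n)` the certified rank-2 block of `VIMInnerModule`.
This file proves exactly that, as pure finite-sum bookkeeping (no certificate involved):
* `Tz`, `Lz`, `Rz` — the integer blocks (all `ℕ` subtractions genuine on the summation box);
* `leading_basic_eq` — `leading (basic n) (basic n) = Σ_{k₃ ≤ n} (−1)^{k₃} C(n,k₃) · Lz n k₃ · Rz n k₃` (in `ℤ`);
* `Lsum n x` — the triple sum with RATIONAL `k₃ = x` over the module blocks `VIMInner.T` (the object of the
  lane's level-2 relations (L-K3)/(L-NK)), and the casts `Tz_cast`, `Rz_cast : (Rz n k₃ : ℚ) = Rsum n k₃`,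
  `Lz_cast : (Lz n k₃ : ℚ) = Lsum n k₃` (`k₃ ≤ n`);
* `A_cast` — `(A n : ℚ) = Σ_{k₃ ≤ n} (−1)^{k₃} C(n,k₃) · Lsum n k₃ · Rsum n k₃`: the level-3 summand of the
  creative-telescoping certificate lives in the rank-6 module `Ann L ⊗ Ann R` over `ℚ(n,k₃)`.
This is the (certificate-independent) first link of the chain `level 1 → level 2 → level 3 → VIMLeadingRecurrence`.
No named facts.
-/

namespace Summit.KontsevichZagierPeriods.Zeta5Search.Certificates

namespace VIMInner

open Finset
open Cells.VanishingMiddleLeading (leading basic term binom shiftBinom sumUpTo binom_eq_choose)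
open Families.CellularVIMRecurrenceLaws (A)

/-! ### The integer blocks -/

/-- The integer inner block `T_ℤ(n;p,q) = Σ_{k ≤ n} (−1)^k C(n,k) C(p−k,n) C(q−k,n)` (`ℕ` subtractions). -/
def Tz (n p q : ℕ) : ℤ :=
  ∑ k ∈ range (n + 1), (-1) ^ k * (n.choose k : ℤ) * ((p - k).choose n : ℤ) * ((q - k).choose n : ℤ)

/-- The integer triple sum `L_ℤ(n,k₃) = Σ_{k₂ ≤ n} (−1)^{k₂} C(n,k₂) · T_ℤ(n;3n−k₃−k₂,2n−k₂) · T_ℤ(n;3n−k₃−k₂,3n−k₃)`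
(the `k₁`-sum is the first block, the `k₄`-sum the second). -/
def Lz (n k₃ : ℕ) : ℤ :=
  ∑ k₂ ∈ range (n + 1), (-1) ^ k₂ * (n.choose k₂ : ℤ) * Tz n (3 * n - k₃ - k₂) (2 * n - k₂) *
    Tz n (3 * n - k₃ - k₂) (3 * n - k₃)

/-- The integer double sum `R_ℤ(n,k₃) = Σ_{k₅ ≤ n} (−1)^{k₅} C(n,k₅) C(3n−k₃−k₅,n) · T_ℤ(n;3n−k₃−k₅,2n−k₅)`
(the `k₆`-sum is the block). -/
def Rz (n k₃ : ℕ) : ℤ :=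
  ∑ k₅ ∈ range (n + 1), (-1) ^ k₅ * (n.choose k₅ : ℤ) * ((3 * n - k₃ - k₅).choose n : ℤ) *
    Tz n (3 * n - k₃ - k₅) (2 * n - k₅)

/-- The 6-fold summand in product form (signs split, all binomials as `ℕ`-binomials). -/
def summand6 (n k₁ k₂ k₃ k₄ k₅ k₆ : ℕ) : ℤ :=
  (-1) ^ (k₁ + k₂ + k₃ + k₄ + k₅ + k₆) *
    ((n.choose k₁ : ℤ) * (n.choose k₂ : ℤ) * (n.choose k₃ : ℤ) * (n.choose k₄ : ℤ) * (n.choose k₅ : ℤ) *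
      (n.choose k₆ : ℤ)) *
    ((2 * n - k₂ - k₁).choose n : ℤ) * ((3 * n - k₃ - k₂ - k₁).choose n : ℤ) *
    ((3 * n - k₃ - k₂ - k₄).choose n : ℤ) * ((3 * n - k₃ - k₄).choose n : ℤ) *
    ((3 * n - k₃ - k₅).choose n : ℤ) * ((3 * n - k₃ - k₅ - k₆).choose n : ℤ) * ((2 * n - k₅ - k₆).choose n : ℤ)

/-! ### Bookkeeping lemmas for the cell's `sumUpTo` / `shiftBinom` / sign conventions -/

/-- `sumUpTo n f = Σ_{k ≤ n} f k`. -/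
theorem sumUpTo_eq (n : ℕ) (f : ℕ → ℤ) : sumUpTo n f = ∑ k ∈ range (n + 1), f k := by
  induction n with
  | zero => simp [sumUpTo]
  | succ n ih =>
    rw [sum_range_succ, ← ih]
    rfl

/-- `shiftBinom n (m − n) = C(m,n)` for naturals `m, n` (both sides vanish when `m < n`). -/
theorem shiftBinom_sub (n m : ℕ) (l : ℤ) (hl : l = (m : ℤ) - n) : shiftBinom n l = (m.choose n : ℤ) := by
  subst hl
  unfold shiftBinom
  by_cases h : (m : ℤ) - n < 0
  · rw [if_pos h, Nat.choose_eq_zero_of_lt (by omega)]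
    simp
  · rw [if_neg h, binom_eq_choose]
    have hnm : n ≤ m := by omega
    have ht : ((m : ℤ) - n).toNat = m - n := by omega
    rw [ht, show n + (m - n) = m by omega, Nat.choose_symm hnm]

/-- The cell's summand at the basic member equals the product form `summand6` (indices in the box). -/
theorem term_basic (n k₁ k₂ k₃ k₄ k₅ k₆ : ℕ) (h₁ : k₁ ≤ n) (h₂ : k₂ ≤ n) (h₃ : k₃ ≤ n) (h₄ : k₄ ≤ n)
    (h₅ : k₅ ≤ n) (h₆ : k₆ ≤ n) :
    term (basic n) (basic n) k₁ k₂ k₃ k₄ k₅ k₆ = summand6 n k₁ k₂ k₃ k₄ k₅ k₆ := by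
  have v1 := shiftBinom_sub n (2 * n - k₂ - k₁) ((n : ℤ) - k₁ - k₂) (by omega)
  have v2 := shiftBinom_sub n (3 * n - k₃ - k₂ - k₁) ((n : ℤ) + n - k₁ - k₂ - k₃) (by omega)
  have v3 := shiftBinom_sub n (3 * n - k₃ - k₂ - k₄) ((n : ℤ) + n - k₂ - k₃ - k₄) (by omega)
  have v4 := shiftBinom_sub n (3 * n - k₃ - k₄) ((n : ℤ) + n - k₃ - k₄) (by omega)
  have v5 := shiftBinom_sub n (3 * n - k₃ - k₅) ((n : ℤ) + n - k₃ - k₅) (by omega)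
  have v6 := shiftBinom_sub n (3 * n - k₃ - k₅ - k₆) ((n : ℤ) + n - k₃ - k₅ - k₆) (by omega)
  have v7 := shiftBinom_sub n (2 * n - k₅ - k₆) ((n : ℤ) - k₅ - k₆) (by omega)
  -- the cell's sign `if Σk even then 1 else −1` is `(−1)^{Σk}`
  have sgn : ∀ m : ℕ, (if m % 2 = 0 then (1 : ℤ) else -1) = (-1) ^ m := fun m => by
    rcases Nat.even_or_odd m with h | h
    · rw [if_pos (Nat.even_iff.mp h), h.neg_one_pow]
    · rw [if_neg (by rw [Nat.odd_iff.mp h]; decide), h.neg_one_pow]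
  simp only [term, basic, v1, v2, v3, v4, v5, v6, v7, sgn, binom_eq_choose]
  unfold summand6
  push_cast
  ring

/-- Triple sum commutation `Σ_a Σ_b Σ_c = Σ_c Σ_b Σ_a`. -/
theorem sum_comm3 {M : Type*} [AddCommMonoid M] (s : Finset ℕ) (f : ℕ → ℕ → ℕ → M) :
    ∑ a ∈ s, ∑ b ∈ s, ∑ c ∈ s, f a b c = ∑ c ∈ s, ∑ b ∈ s, ∑ a ∈ s, f a b c := by
  rw [Finset.sum_comm]
  rw [Finset.sum_congr rfl fun b _ => Finset.sum_comm]
  rw [Finset.sum_comm]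

/-! ### The factorisation -/

/-- The cell's 6-fold sum as an iterated `Finset` sum of `summand6`. -/
theorem leading_basic_sum6 (n : ℕ) :
    leading (basic n) (basic n) = ∑ k₁ ∈ range (n + 1), ∑ k₂ ∈ range (n + 1), ∑ k₃ ∈ range (n + 1),
      ∑ k₄ ∈ range (n + 1), ∑ k₅ ∈ range (n + 1), ∑ k₆ ∈ range (n + 1), summand6 n k₁ k₂ k₃ k₄ k₅ k₆ := by
  simp only [leading, basic, sumUpTo_eq]
  refine sum_congr rfl fun k₁ h₁ => sum_congr rfl fun k₂ h₂ => sum_congr rfl fun k₃ h₃ =>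
    sum_congr rfl fun k₄ h₄ => sum_congr rfl fun k₅ h₅ => sum_congr rfl fun k₆ h₆ => ?_
  rw [mem_range, Nat.lt_succ_iff] at h₁ h₂ h₃ h₄ h₅ h₆
  have := term_basic n k₁ k₂ k₃ k₄ k₅ k₆ h₁ h₂ h₃ h₄ h₅ h₆
  simpa only [basic] using this

/-- `L_ℤ` expanded: `Σ_{k₂} Σ_{k₁} Σ_{k₄}` of the product of its three factors. -/
theorem Lz_expand (n k₃ : ℕ) :
    Lz n k₃ = ∑ k₂ ∈ range (n + 1), ∑ k₁ ∈ range (n + 1), ∑ k₄ ∈ range (n + 1),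
      (-1) ^ k₂ * (n.choose k₂ : ℤ) *
        ((-1) ^ k₁ * (n.choose k₁ : ℤ) * ((3 * n - k₃ - k₂ - k₁).choose n : ℤ) * ((2 * n - k₂ - k₁).choose n : ℤ)) *
        ((-1) ^ k₄ * (n.choose k₄ : ℤ) * ((3 * n - k₃ - k₂ - k₄).choose n : ℤ) * ((3 * n - k₃ - k₄).choose n : ℤ)) := by
  unfold Lz Tz
  refine sum_congr rfl fun k₂ _ => ?_
  rw [mul_assoc, Finset.sum_mul_sum, Finset.mul_sum]
  refine sum_congr rfl fun k₁ _ => ?_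
  rw [Finset.mul_sum]
  refine sum_congr rfl fun k₄ _ => ?_
  ring

/-- `R_ℤ` expanded: `Σ_{k₅} Σ_{k₆}` of the product of its two factors. -/
theorem Rz_expand (n k₃ : ℕ) :
    Rz n k₃ = ∑ k₅ ∈ range (n + 1), ∑ k₆ ∈ range (n + 1),
      (-1) ^ k₅ * (n.choose k₅ : ℤ) * ((3 * n - k₃ - k₅).choose n : ℤ) *
        ((-1) ^ k₆ * (n.choose k₆ : ℤ) * ((3 * n - k₃ - k₅ - k₆).choose n : ℤ) * ((2 * n - k₅ - k₆).choose n : ℤ)) := by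
  unfold Rz Tz
  refine sum_congr rfl fun k₅ _ => ?_
  rw [Finset.mul_sum]

/-- One `k₃`-slice of the factorised form, expanded to a 5-fold sum of `summand6`. -/
theorem slice_expand (n k₃ : ℕ) :
    (-1) ^ k₃ * (n.choose k₃ : ℤ) * Lz n k₃ * Rz n k₃ = ∑ k₂ ∈ range (n + 1), ∑ k₁ ∈ range (n + 1),
      ∑ k₄ ∈ range (n + 1), ∑ k₅ ∈ range (n + 1), ∑ k₆ ∈ range (n + 1), summand6 n k₁ k₂ k₃ k₄ k₅ k₆ := by
  have hA : (-1) ^ k₃ * (n.choose k₃ : ℤ) * Lz n k₃ = ∑ k₂ ∈ range (n + 1), ∑ k₁ ∈ range (n + 1),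
      ∑ k₄ ∈ range (n + 1), (-1) ^ k₃ * (n.choose k₃ : ℤ) * ((-1) ^ k₂ * (n.choose k₂ : ℤ) *
        ((-1) ^ k₁ * (n.choose k₁ : ℤ) * ((3 * n - k₃ - k₂ - k₁).choose n : ℤ) * ((2 * n - k₂ - k₁).choose n : ℤ)) *
        ((-1) ^ k₄ * (n.choose k₄ : ℤ) * ((3 * n - k₃ - k₂ - k₄).choose n : ℤ) *
          ((3 * n - k₃ - k₄).choose n : ℤ))) := by
    rw [Lz_expand]
    simp_rw [Finset.mul_sum]
  rw [hA, Rz_expand]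
  simp_rw [Finset.sum_mul]
  simp_rw [Finset.mul_sum]
  refine sum_congr rfl fun k₂ _ => sum_congr rfl fun k₁ _ => sum_congr rfl fun k₄ _ =>
    sum_congr rfl fun k₅ _ => sum_congr rfl fun k₆ _ => ?_
  unfold summand6
  ring

/-- **The factorisation of the 6-fold sum**: `A(n) = Σ_{k₃ ≤ n} (−1)^{k₃} C(n,k₃) · L_ℤ(n,k₃) · R_ℤ(n,k₃)`. -/
theorem leading_basic_eq (n : ℕ) :
    leading (basic n) (basic n) = ∑ k₃ ∈ range (n + 1), (-1) ^ k₃ * (n.choose k₃ : ℤ) * Lz n k₃ * Rz n k₃ := by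
  rw [leading_basic_sum6]
  simp_rw [slice_expand]
  exact sum_comm3 (range (n + 1)) fun k₁ k₂ k₃ => ∑ k₄ ∈ range (n + 1), ∑ k₅ ∈ range (n + 1),
    ∑ k₆ ∈ range (n + 1), summand6 n k₁ k₂ k₃ k₄ k₅ k₆

/-- The same for `A` of `Families/CellularVIMRecurrenceLaws`. -/
theorem A_eq (n : ℕ) : A n = ∑ k₃ ∈ range (n + 1), (-1) ^ k₃ * (n.choose k₃ : ℤ) * Lz n k₃ * Rz n k₃ :=
  leading_basic_eq n

/-! ### The rational-parameter triple sum and the casts -/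

/-- The inner TRIPLE sum with rational `k₃ = x`:
`L(n,x) = Σ_{k₂ ≤ n} (−1)^{k₂} C(n,k₂) · T(n; 3n−x−k₂, 3n−x) · T(n; 3n−x−k₂, 2n−k₂)` over the certified block `T`. -/
def Lsum (n : ℕ) (x : ℚ) : ℚ :=
  ∑ k ∈ range (n + 1), (-1) ^ k * ((n.choose k : ℕ) : ℚ) *
    (T n (3 * (n : ℚ) - x - k) (3 * (n : ℚ) - x) * T n (3 * (n : ℚ) - x - k) (2 * (n : ℚ) - k))

/-- `T_ℤ(n;p,q) = T(n;p,q)` at lattice points `p, q ≥ n`. -/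
theorem Tz_cast (n p q : ℕ) (hp : n ≤ p) (hq : n ≤ q) : ((Tz n p q : ℤ) : ℚ) = T n p q := by
  rw [T_natCast n p q hp hq]
  unfold Tz
  push_cast
  rfl

/-- `R_ℤ(n,k₃) = Rsum n k₃` for `k₃ ≤ n`. -/
theorem Rz_cast (n k₃ : ℕ) (h : k₃ ≤ n) : ((Rz n k₃ : ℤ) : ℚ) = Rsum n (k₃ : ℚ) := by
  rw [Rsum_natCast n k₃ h]
  unfold Rz Tz RsumNat
  push_cast
  rfl

/-- `L_ℤ(n,k₃) = Lsum n k₃` for `k₃ ≤ n`. -/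
theorem Lz_cast (n k₃ : ℕ) (h : k₃ ≤ n) : ((Lz n k₃ : ℤ) : ℚ) = Lsum n (k₃ : ℚ) := by
  unfold Lz Lsum
  push_cast
  refine sum_congr rfl fun k₂ hk₂ => ?_
  have hk : k₂ ≤ n := Nat.lt_succ_iff.mp (mem_range.mp hk₂)
  have e1 : (3 * (n : ℚ) - k₃ - k₂) = ((3 * n - k₃ - k₂ : ℕ) : ℚ) := by
    rw [Nat.cast_sub (by omega), Nat.cast_sub (by omega)]; push_cast; ring
  have e2 : (3 * (n : ℚ) - k₃) = ((3 * n - k₃ : ℕ) : ℚ) := by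
    rw [Nat.cast_sub (by omega)]; push_cast; ring
  have e3 : (2 * (n : ℚ) - k₂) = ((2 * n - k₂ : ℕ) : ℚ) := by
    rw [Nat.cast_sub (by omega)]; push_cast; ring
  rw [e1, e2, e3, Tz_cast n _ _ (by omega) (by omega), Tz_cast n _ _ (by omega) (by omega)]
  ring

/-- **`A(n)` over the module blocks**: `(A n : ℚ) = Σ_{k₃ ≤ n} (−1)^{k₃} C(n,k₃) · Lsum n k₃ · Rsum n k₃`. -/
theorem A_cast (n : ℕ) : ((A n : ℤ) : ℚ) =
    ∑ k₃ ∈ range (n + 1), (-1) ^ k₃ * ((n.choose k₃ : ℕ) : ℚ) * Lsum n (k₃ : ℚ) * Rsum n (k₃ : ℚ) := by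
  rw [A_eq]
  push_cast
  refine sum_congr rfl fun k₃ hk₃ => ?_
  have hk : k₃ ≤ n := Nat.lt_succ_iff.mp (mem_range.mp hk₃)
  rw [Rz_cast n k₃ hk, Lz_cast n k₃ hk]

end VIMInner

end Summit.KontsevichZagierPeriods.Zeta5Search.Certificates
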